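import Summits.AtomisticToContinuum.Crystallization.Theorems.FrustratedLawDichotomySignedLedgerErgodic

/-!
# FrustratedLawDichotomy · crux `AperiodicFrustratedLawGap` (stmt-AtomisticToContinuum-27623) — REGIMES AS TRANSLATION-INVARIANT PROPERTIES OF THE ATOM SET
# (decomp-a2c hand-2 g45, STRUCTURAL share #51: DEF-FREE companion of `…SignedLedgerErgodic` §2)

`…SignedLedgerErgodic.nonempty_lawLedger_of_ergodic_regimes` dispatches the E′ ledger over countably many regimes `A i ⊆ Measure E3` and asks of
each regime two side conditions (critic r1695 (A): «the only non-verbatim hypotheses of §2»): measurability, and RE-ROOTING INVARIANCE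
`μ ∈ A i ↔ θ_p μ ∈ A i` at atoms `p`.  The regimes of the E′ list (single coherent grain, polycrystal / dense cell, interface, hole-bearing, …) are all
of the form «the ATOM SET `{x | μ {x} ≠ 0}` has a translation-invariant property `Φ`».  For such regimes invariance is automatic, with NO new
definitions:

* `singleton_map_sub_ne_zero_iff` / `atoms_map_sub` — the atoms of the re-rooted configuration `θ_p μ = μ.map (· − p)` are the translated atoms
  `(· − p) '' {x | μ {x} ≠ 0}` (for EVERY measure `μ` and every `p`, atom or not);
* `rerootInvariant_of_translationInvariant` — if `Φ ((· − t) '' S) ↔ Φ S` for all `S`, `t`, the regime `{μ | Φ (atoms μ)}` satisfies the invariance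
  hypothesis of §2 verbatim;
* `atoms_eq_of_isRootedHardCore` — on a rooted hard-core configuration `count|S` the atom set IS `S` (so `Φ` is read on the point set itself);
* ★ `nonempty_lawLedger_of_ergodic_atomRegimes` — `nonempty_lawLedger_of_ergodic_regimes` restated for atom-set regimes: per translation-invariant
  `Φ i` only MEASURABILITY of `{μ | Φ i (atoms μ)}` is still owed, plus the a.e. cover `∃ i, Φ i (atoms μ)` and the per-regime ledgers;
* `exists_ae_atomRegime_of_ergodic_cover` — the same dispatch without ledgers (one `Φ i` holds almost surely).

Tags: [folklore: bookkeeping].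
-/

noncomputable section

namespace Summit.AtomisticToContinuum.Crystallization.Theorems.FrustratedLawDichotomySignedLedgerRegimes

open MeasureTheory Metric Set Filter
open scoped ENNReal Topology BigOperators
open Literature.MathematicalPhysics.StatisticalMechanics Literature.Probability.Process
open Summit.AtomisticToContinuum.Crystallization.Theorems.ChargedEnergyGapNegative (E3 eStar)
open Summit.AtomisticToContinuum.Crystallization.Theorems.FrustratedLawDichotomySignedLedger (LawLedger)
open Summit.AtomisticToContinuum.Crystallization.Theorems.FrustratedLawDichotomySignedLedgerErgodic
  (exists_ae_mem_of_ergodic_cover nonempty_lawLedger_of_ergodic_regimes)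
open Summit.AtomisticToContinuum.Crystallization.Theorems.FrustratedLawDichotomyFiniteClusterGap (setOf_count_restrict_singleton_ne_zero)

variable {P : Measure (Measure E3)}

/-! ## §1. Atoms of the re-rooted configuration -/

/-- The point `x` is an atom of `θ_p μ = μ.map (· − p)` iff `x + p` is an atom of `μ` (any measure, any `p`). [folklore] -/
theorem singleton_map_sub_ne_zero_iff (μ : Measure E3) (p x : E3) :
    (μ.map fun z : E3 => z - p) {x} ≠ 0 ↔ μ {x + p} ≠ 0 := by
  rw [Measure.map_apply (measurable_sub_const p) (measurableSet_singleton x)]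
  have : (fun z : E3 => z - p) ⁻¹' {x} = {x + p} := by
    ext z
    simp only [mem_preimage, mem_singleton_iff, sub_eq_iff_eq_add]
  rw [this]

/-- **The atoms of the re-rooted configuration are the translated atoms**: `atoms (θ_p μ) = (· − p) '' atoms μ`. [folklore] -/
theorem atoms_map_sub (μ : Measure E3) (p : E3) :
    {x : E3 | (μ.map fun z : E3 => z - p) {x} ≠ 0} = (fun x : E3 => x - p) '' {x : E3 | μ {x} ≠ 0} := by
  ext x
  rw [mem_setOf_eq, singleton_map_sub_ne_zero_iff]
  constructor
  · intro hx
    exact ⟨x + p, hx, add_sub_cancel_right x p⟩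
  · rintro ⟨y, hy, rfl⟩
    rwa [mem_setOf_eq, sub_add_cancel] at *

/-- On a rooted hard-core configuration `count|S` the atom set is `S`. [folklore] -/
theorem atoms_eq_of_isRootedHardCore {δ : ℝ} {μ : Measure E3} (hμ : IsRootedHardCore δ μ) :
    ∃ S : Set E3, (0 : E3) ∈ S ∧ (∀ x ∈ S, ∀ y ∈ S, x ≠ y → δ ≤ dist x y) ∧
      μ = (Measure.count : Measure E3).restrict S ∧ {x : E3 | μ {x} ≠ 0} = S := by
  obtain ⟨S, h0, hsep, rfl⟩ := hμ
  exact ⟨S, h0, hsep, rfl, setOf_count_restrict_singleton_ne_zero S⟩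

/-! ## §2. Translation-invariant properties of the atom set are re-rooting-invariant regimes -/

/-- **RE-ROOTING INVARIANCE FOR FREE.**  If `Φ` is invariant under translating the point set, the regime `{μ | Φ (atoms μ)}` satisfies the
invariance hypothesis of `…SignedLedgerErgodic.exists_ae_mem_of_ergodic_cover` verbatim (indeed for every `p`, atom or not). [folklore] -/
theorem rerootInvariant_of_translationInvariant {Φ : Set E3 → Prop}
    (hΦ : ∀ (S : Set E3) (t : E3), Φ ((fun x : E3 => x - t) '' S) ↔ Φ S) :
    ∀ μ : Measure E3, ∀ p : E3, μ {p} ≠ 0 →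
      (μ ∈ {μ : Measure E3 | Φ {x : E3 | μ {x} ≠ 0}} ↔
        Measure.map (fun z : E3 => z - p) μ ∈ {μ : Measure E3 | Φ {x : E3 | μ {x} ≠ 0}}) := by
  intro μ p _
  rw [mem_setOf_eq, mem_setOf_eq, atoms_map_sub, hΦ]

/-- **ONE ATOM-SET REGIME CARRIES AN ERGODIC LAW.**  Countably many translation-invariant properties `Φ i` of point sets with measurable regimes
`{μ | Φ i (atoms μ)}` covering almost every configuration: under the residual's ergodicity clause (verbatim) one `Φ i` holds almost surely.
[folklore: ergodicity] -/
theorem exists_ae_atomRegime_of_ergodic_cover [IsProbabilityMeasure P] {ι : Type*} [Countable ι] (Φ : ι → Set E3 → Prop)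
    (hΦ : ∀ i (S : Set E3) (t : E3), Φ i ((fun x : E3 => x - t) '' S) ↔ Φ i S)
    (hmeas : ∀ i, MeasurableSet {μ : Measure E3 | Φ i {x : E3 | μ {x} ≠ 0}})
    (herg : ∀ A : Set (MeasureTheory.Measure (EuclideanSpace ℝ (Fin 3))), MeasurableSet A → (∀ μ : MeasureTheory.Measure (EuclideanSpace ℝ (Fin 3)), ∀ p : EuclideanSpace ℝ (Fin 3), μ {p} ≠ 0 → (μ ∈ A ↔ MeasureTheory.Measure.map (fun z : EuclideanSpace ℝ (Fin 3) => z - p) μ ∈ A)) → P A = 0 ∨ P Aᶜ = 0)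
    (hcover : ∀ᵐ μ ∂P, ∃ i, Φ i {x : E3 | μ {x} ≠ 0}) : ∃ i, ∀ᵐ μ ∂P, Φ i {x : E3 | μ {x} ≠ 0} :=
  exists_ae_mem_of_ergodic_cover (fun i => {μ : Measure E3 | Φ i {x : E3 | μ {x} ≠ 0}}) hmeas
    (fun i => rerootInvariant_of_translationInvariant (hΦ i)) herg hcover

/-- **LEDGER BY ATOM-SET REGIMES.**  `…SignedLedgerErgodic.nonempty_lawLedger_of_ergodic_regimes` for regimes given by translation-invariant
properties of the atom set: per regime only the measurability of `{μ | Φ i (atoms μ)}`, the a.e. cover and the per-regime ledger (proved for laws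
almost surely in the regime) are owed. [folklore: ergodicity] -/
theorem nonempty_lawLedger_of_ergodic_atomRegimes [IsProbabilityMeasure P] {c : ℝ} {ι : Type*} [Countable ι] (Φ : ι → Set E3 → Prop)
    (hΦ : ∀ i (S : Set E3) (t : E3), Φ i ((fun x : E3 => x - t) '' S) ↔ Φ i S)
    (hmeas : ∀ i, MeasurableSet {μ : Measure E3 | Φ i {x : E3 | μ {x} ≠ 0}})
    (herg : ∀ A : Set (MeasureTheory.Measure (EuclideanSpace ℝ (Fin 3))), MeasurableSet A → (∀ μ : MeasureTheory.Measure (EuclideanSpace ℝ (Fin 3)), ∀ p : EuclideanSpace ℝ (Fin 3), μ {p} ≠ 0 → (μ ∈ A ↔ MeasureTheory.Measure.map (fun z : EuclideanSpace ℝ (Fin 3) => z - p) μ ∈ A)) → P A = 0 ∨ P Aᶜ = 0)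
    (hcover : ∀ᵐ μ ∂P, ∃ i, Φ i {x : E3 | μ {x} ≠ 0})
    (hpiece : ∀ i, (∀ᵐ μ ∂P, Φ i {x : E3 | μ {x} ≠ 0}) → Nonempty (LawLedger P c)) : Nonempty (LawLedger P c) := by
  obtain ⟨i, hi⟩ := exists_ae_atomRegime_of_ergodic_cover Φ hΦ hmeas herg hcover
  exact hpiece i hi

end Summit.AtomisticToContinuum.Crystallization.Theorems.FrustratedLawDichotomySignedLedgerRegimes

end
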